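import Mathlib
import Summits.Ventures.PercRepro2.CrossAPrimeA2VEdge
import Summits.Ventures.PercRepro2.Independence

/-!
# The sign of `crossA′so` when one mark is independent of the rest
(blind cell PercRepro2, p5 g35; S4 §2.4 (s) addendum 33 (2)(i)–(ii))

If the membership `{o ∈ C(a₂)}` is determined by a set `B` of edges while `{a₂ ↮ a₁}`,
`{b ∈ C(a₂)}` and `{a₁ ↔ v}` are determined by the edges off `B` (e.g. `o` sits in a component
attached to `a₂` alone), then the route masses factor, `x = F·Z`, `xv = F·P(Q, a₁ ↔ v)`,
`t = F·y`, `Dv = F·yv`, and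

  `crossC(c) = F·(Z·yv + y·(c·Z − P(Q, a₁ ↔ v))) ≥ 0`

for every admissible `c` (`P(Q, a₁ ↔ v) ≤ c·Z` by `prob_Q_vL_le_mul` with `𝓤 = univ`), hence
`crossA′so ≥ 0` (**`crossA'so_nonneg_of_indep_o`**).  Own work; standard axioms.
-/

namespace Summit.Ventures.PercRepro2

open LeafRowPendantRootSO CrossAPrimeA2Route CrossAPrimeA2Induction CrossAPrimeA2VEdge

namespace CrossAPrimeIndepMark

variable {V : Type*} {E : Type*} [Fintype E] [DecidableEq E] [Fintype V] [DecidableEq V]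
  {R : Type*} [Field R] [LinearOrder R] [IsStrictOrderedRing R]
variable {ends : E → Sym2 V}

omit [DecidableEq V] in
/-- **The sign of `crossA′so` with `o` independent of the rest**: if `{o ∈ K}` is determined by
the edges of `B` and `{a₂ ↮ a₁}`, `{b ∈ K}`, `{a₁ ↔ v}` by the edges off `B`, then
`0 ≤ crossA'so p ends o a₁ a₂ v b`. -/
theorem crossA'so_nonneg_of_indep_o (p : E → R) (hp : IsProbVec p) {o a₁ a₂ v b : V}
    {B : Set E} [DecidablePred (· ∈ B)]
    (hO : DependsOn (· ∈ connEvent ends a₂ o) B)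
    (hQ : DependsOn (· ∈ avoidAll ends a₂ {a₁}) Bᶜ)
    (hB : DependsOn (· ∈ connEvent ends a₂ b) Bᶜ)
    (hL : DependsOn (· ∈ connEvent ends a₁ v) Bᶜ) :
    0 ≤ crossA'so p ends o a₁ a₂ v b := by
  classical
  -- the factorisations
  have hdisj : Disjoint Bᶜ B := disjoint_compl_left
  have hQL : DependsOn (· ∈ avoidAll ends a₂ {a₁} ∩ connEvent ends a₁ v) Bᶜ := by
    have := dependsOn_inter hQ hL
    rwa [Set.union_self] at this
  have hQB : DependsOn (· ∈ avoidAll ends a₂ {a₁} ∩ connEvent ends a₂ b) Bᶜ := by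
    have := dependsOn_inter hQ hB
    rwa [Set.union_self] at this
  have hQLB : DependsOn (· ∈ avoidAll ends a₂ {a₁} ∩ (connEvent ends a₁ v ∩ connEvent ends a₂ b))
      Bᶜ := by
    have := dependsOn_inter hQ (dependsOn_inter hL hB)
    rwa [Set.union_self, Set.union_self] at this
  have e_x : prob p (avoidAll ends a₂ {a₁} ∩ connEvent ends a₂ o) =
      prob p (avoidAll ends a₂ {a₁}) * prob p (connEvent ends a₂ o) :=
    prob_inter_eq_mul_of_dependsOn p hdisj hQ hO
  have e_xv : prob p (avoidAll ends a₂ {a₁} ∩ (connEvent ends a₁ v ∩ connEvent ends a₂ o)) =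
      prob p (avoidAll ends a₂ {a₁} ∩ connEvent ends a₁ v) * prob p (connEvent ends a₂ o) := by
    rw [← Set.inter_assoc]
    exact prob_inter_eq_mul_of_dependsOn p hdisj hQL hO
  have e_Dv : prob p (avoidAll ends a₂ {a₁} ∩
      (connEvent ends a₁ v ∩ (connEvent ends a₂ o ∩ connEvent ends a₂ b))) =
      prob p (avoidAll ends a₂ {a₁} ∩ (connEvent ends a₁ v ∩ connEvent ends a₂ b)) *
        prob p (connEvent ends a₂ o) := by
    rw [show avoidAll ends a₂ {a₁} ∩ (connEvent ends a₁ v ∩ (connEvent ends a₂ o ∩ connEvent ends a₂ b)) =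
      avoidAll ends a₂ {a₁} ∩ (connEvent ends a₁ v ∩ connEvent ends a₂ b) ∩ connEvent ends a₂ o by
        ext ω; simp only [Set.mem_inter_iff]; tauto]
    exact prob_inter_eq_mul_of_dependsOn p hdisj hQLB hO
  -- the admissible constant `c = P(a₁ ↔ v in G ∖ {a₂}) ≤ π` and `ℓ ≤ c·Z`
  have hadm := adm_del_a2 (ends := ends) hp a₁ a₂ v
  have hcπ := prob_del_a2_le (ends := ends) hp a₁ a₂ v
  have hℓc : prob p (avoidAll ends a₂ {a₁} ∩ connEvent ends a₁ v) ≤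
      prob p (delConn ends {a₂} a₁ v) * prob p (avoidAll ends a₂ {a₁}) := by
    have h := prob_Q_vL_le_mul hp hadm (Set.univ : Set (Set V))
    have e1 : clusterInEvent ends a₂ Set.univ ∩ connEvent ends a₁ v ∩ avoidAll ends a₂ {a₁} =
        avoidAll ends a₂ {a₁} ∩ connEvent ends a₁ v := by
      ext ω; simp [clusterInEvent, Set.inter_comm]
    have e2 : clusterInEvent ends a₂ Set.univ ∩ avoidAll ends a₂ {a₁} = avoidAll ends a₂ {a₁} := by
      ext ω; simp [clusterInEvent]
    rw [e1, e2] at h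
    exact h
  refine crossA'so_nonneg_of_crossC hp o a₁ a₂ v b hcπ ?_
  unfold crossC
  rw [e_x, e_xv, e_Dv]
  have hF : 0 ≤ prob p (connEvent ends a₂ o) := prob_nonneg hp _
  have hZ : 0 ≤ prob p (avoidAll ends a₂ {a₁}) := prob_nonneg hp _
  have hy : 0 ≤ prob p (avoidAll ends a₂ {a₁} ∩ connEvent ends a₂ b) := prob_nonneg hp _
  have hyv : 0 ≤ prob p (avoidAll ends a₂ {a₁} ∩ (connEvent ends a₁ v ∩ connEvent ends a₂ b)) :=
    prob_nonneg hp _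
  have k1 := mul_nonneg hF (mul_nonneg hZ hyv)
  have k2 := mul_nonneg hF (mul_nonneg hy (sub_nonneg.2 hℓc))
  nlinarith [k1, k2]

end CrossAPrimeIndepMark

end Summit.Ventures.PercRepro2
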